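import Literature.Probability.RandomPlanarGeometry.LoewnerAdaptedPlane
import Literature.Probability.RandomPlanarGeometry.SLE
import Literature.Probability.Process.KolmogorovExtensionProofs
import Mathlib.Analysis.ODE.Gronwall
import Mathlib.MeasureTheory.Function.StronglyMeasurable.Basic
import HarnessLib

/-!
# The swallowing indicator `(ω, z) ↦ 1[z ∈ Kₜ(ω)]` is jointly measurable

Topic `Probability/RandomPlanarGeometry`; theorems only. Companion of `LoewnerAdaptedPlane.lean`,
which proves that for a FIXED starting point `z ∈ ℍ` the event `{t < T_z}` ("`z` is not yet
swallowed") is a measurable functional of a measurable family of continuous driving paths. Here the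
starting point varies: for `t > 0` the set `{(ω, z) | z ∈ ℍ, t < T_z[W ω]}` is measurable in
`Ω × ℂ` (`Loewner.measurableSet_lt_swallowingTime_prod`), hence so is the swallowing indicator of
the SLE_κ hulls, `{(ω, z) | z ∈ Kₜ(ω)}` (`measurableSet_mem_sleHull_prod`). This is the joint
measurability that Fubini arguments over the swallowed region need (e.g. Rohde–Schramm (2005),
proof of Lemma 7.3, case `κ > 8`, p. 910: "`area(∂Kₜ) ≥ ∫ 1_{t > τ(z)} dx dy`, and Fubini implies
…"; in `SLETransienceKappaEight.lean` this was circumvented through the measurable trace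
functional, which needs the chain to be generated by a curve — the statement here is curve-free).

Proof: the countable description `{t < T_z} = ⋃ₙ farEventC n` of `LoewnerAdaptedPlane.lean` is by
the truncated flows `h^m_z`, which are measurable in `ω` (`Loewner.measurable_truncFlowC`) and, the
truncated field being globally Lipschitz (`Loewner.lipschitzWith_fwdField`), Lipschitz in the
starting point by Grönwall (`Loewner.continuous_truncFlowC_init`); a function measurable in one
variable and continuous in the other is jointly measurable
(`measurable_uncurry_of_continuous_of_measurable`).

## Mathlib

We USE `dist_le_of_trajectories_ODE` (Grönwall's inequality for exact solutions),
`HasDerivWithinAt.mono_of_mem_nhdsWithin`, `Icc_mem_nhdsGE_of_mem`,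
`measurable_uncurry_of_continuous_of_measurable`, `measurable_swap`.

## References

* S. Rohde, O. Schramm, *Basic properties of SLE*, Ann. of Math. 161 (2005), §2.1 (the flow and
  `τ(z)`), proof of Lemma 7.3 (p. 910).
* G. F. Lawler, *Conformally Invariant Processes in the Plane*, AMS (2005), Ch. 4 §4.1.
-/

noncomputable section

open Set Filter Topology MeasureTheory Metric Complex
open UpperHalfPlane (upperHalfPlaneSet isOpen_upperHalfPlaneSet)
open scoped NNReal ENNReal

namespace Literature.Probability.RandomPlanarGeometry

namespace Loewner

section JointMeasurable

variable {Ω : Type*} {mΩ : MeasurableSpace Ω} {W : Ω → ℝ≥0 → ℝ} {t : ℝ≥0}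

/-- **The truncated flow depends continuously on its starting point** (Grönwall,
`dist_le_of_trajectories_ODE`: the truncated field is globally Lipschitz, `lipschitzWith_fwdField`):
at every time `s ∈ [0, t]`, `x ↦ h^m_x(s)` is continuous (indeed `e^{Ks}`-Lipschitz, `K = 2/m²`).
Lawler (2005), Ch. 4 §4.1 (the flow); a technical device, no claim of provenance. [folklore] -/
theorem continuous_truncFlowC_init (hc : ∀ ω, Continuous (W ω)) {m : ℝ} (hm : 0 < m) (ω : Ω)
    {s : ℝ} (hs : s ∈ Icc (0 : ℝ) t) :
    Continuous fun x : ℂ ↦ truncFlowC t hc hm x ω s := by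
  set K : ℝ≥0 := 2 / m.toNNReal ^ 2 with hK
  have hv : ∀ r : ℝ, LipschitzWith K (fwdField (W ω) m r) := fun r ↦ lipschitzWith_fwdField hm r
  have hder : ∀ x : ℂ, ∀ r ∈ Ico (0 : ℝ) t, HasDerivWithinAt (truncFlowC t hc hm x ω)
      (fwdField (W ω) m r (truncFlowC t hc hm x ω r)) (Ici r) r := fun x r hr ↦
    (hasDerivWithinAt_truncFlowC hc hm x ω (Ico_subset_Icc_self hr)).mono_of_mem_nhdsWithin
      (Icc_mem_nhdsGE_of_mem hr)
  have hdist : ∀ x y : ℂ, dist (truncFlowC t hc hm x ω s) (truncFlowC t hc hm y ω s) ≤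
      dist x y * Real.exp (K * (s - 0)) := fun x y ↦
    dist_le_of_trajectories_ODE hv (continuous_truncFlowC hc hm x ω).continuousOn (hder x)
      (continuous_truncFlowC hc hm y ω).continuousOn (hder y)
      (by rw [truncFlowC_zero, truncFlowC_zero]) s hs
  refine Metric.continuous_iff.2 fun x ε hε ↦ ?_
  have hC : 0 < Real.exp (K * (s - 0)) := Real.exp_pos _
  refine ⟨ε / Real.exp (K * (s - 0)), div_pos hε hC, fun y hy ↦ ?_⟩
  calc dist (truncFlowC t hc hm y ω s) (truncFlowC t hc hm x ω s)
      ≤ dist y x * Real.exp (K * (s - 0)) := hdist y x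
    _ < ε / Real.exp (K * (s - 0)) * Real.exp (K * (s - 0)) := by gcongr
    _ = ε := div_mul_cancel₀ ε hC.ne'

/-- The truncated flow is jointly measurable in `(ω, x)` at every time `s ∈ [0, t]` (measurable in
`ω`, `measurable_truncFlowC`; continuous in `x`, `continuous_truncFlowC_init`;
`measurable_uncurry_of_continuous_of_measurable`). [folklore] -/
theorem measurable_truncFlowC_prod (hc : ∀ ω, Continuous (W ω))
    (hmeas : ∀ s, s ≤ t → Measurable fun ω ↦ W ω s) {m : ℝ} (hm : 0 < m)
    {s : ℝ} (hs : s ∈ Icc (0 : ℝ) t) :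
    Measurable fun p : Ω × ℂ ↦ truncFlowC t hc hm p.2 p.1 s := by
  set u : ℂ → Ω → ℂ := fun x ω ↦ truncFlowC t hc hm x ω s with hu
  have hu_cont : ∀ ω, Continuous fun x ↦ u x ω := fun ω ↦ continuous_truncFlowC_init hc hm ω hs
  have hu_meas : ∀ x, Measurable (u x) := fun x ↦ measurable_truncFlowC hc hmeas hm x s
  have h : Measurable (Function.uncurry u) :=
    measurable_uncurry_of_continuous_of_measurable hu_cont hu_meas
  have heq : (fun p : Ω × ℂ ↦ truncFlowC t hc hm p.2 p.1 s) = Function.uncurry u ∘ Prod.swap := by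
    funext p
    rfl
  rw [heq]
  exact h.comp measurable_swap

/-- **"Not yet swallowed" is jointly measurable**: for `t > 0` and a measurable family of continuous
driving paths, the set `{(ω, z) | z ∈ ℍ, t < T_z[W ω]}` is measurable in `Ω × ℂ` — the countable
description `setOf_lt_swallowingTime_eq_iUnion_of_im_pos` by the truncated flows, uniformly in the
starting point, with `measurable_truncFlowC_prod`. Rohde–Schramm (2005), §2.1.
[cite: RohdeSchramm2005, §2.1] -/
theorem measurableSet_lt_swallowingTime_prod (hc : ∀ ω, Continuous (W ω))
    (hmeas : ∀ s, s ≤ t → Measurable fun ω ↦ W ω s) (ht : 0 < t) :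
    MeasurableSet {p : Ω × ℂ | 0 < p.2.im ∧ (t : WithTop ℝ≥0) < swallowingTime (W p.1) p.2} := by
  -- the countable description, uniformly in the starting point
  set F : ℕ → Set (Ω × ℂ) := fun n ↦ ⋂ q : ℚ, {p | (q : ℝ) ∈ Icc (0 : ℝ) t →
    2 * (1 / (n + 1 : ℝ)) ≤ (truncFlowC t hc (one_div_succ_pos n) p.2 p.1 q).im} with hF
  have hFm : ∀ n, MeasurableSet (F n) := by
    intro n
    refine MeasurableSet.iInter fun q ↦ ?_
    by_cases hq : (q : ℝ) ∈ Icc (0 : ℝ) t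
    · have hm : Measurable fun p : Ω × ℂ ↦ (truncFlowC t hc (one_div_succ_pos n) p.2 p.1 q).im :=
        Complex.measurable_im.comp (measurable_truncFlowC_prod hc hmeas _ hq)
      have : {p : Ω × ℂ | (q : ℝ) ∈ Icc (0 : ℝ) t →
          2 * (1 / (n + 1 : ℝ)) ≤ (truncFlowC t hc (one_div_succ_pos n) p.2 p.1 q).im} =
          {p | 2 * (1 / (n + 1 : ℝ)) ≤ (truncFlowC t hc (one_div_succ_pos n) p.2 p.1 q).im} := by
        ext p; simp [hq]
      rw [this]
      exact measurableSet_le measurable_const hm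
    · have : {p : Ω × ℂ | (q : ℝ) ∈ Icc (0 : ℝ) t →
          2 * (1 / (n + 1 : ℝ)) ≤ (truncFlowC t hc (one_div_succ_pos n) p.2 p.1 q).im} = univ := by
        ext p; simp only [mem_setOf_eq, mem_univ, iff_true]; exact fun h ↦ absurd h hq
      rw [this]
      exact MeasurableSet.univ
  have hFiff : ∀ n (p : Ω × ℂ), p ∈ F n ↔ p.1 ∈ farEventC W t hc p.2 n := fun n p ↦ by
    simp only [hF, farEventC, mem_iInter, mem_setOf_eq]
  have heq : {p : Ω × ℂ | 0 < p.2.im ∧ (t : WithTop ℝ≥0) < swallowingTime (W p.1) p.2} =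
      {p : Ω × ℂ | 0 < p.2.im} ∩ ⋃ n, F n := by
    ext p
    simp only [mem_inter_iff, mem_setOf_eq, mem_iUnion]
    constructor
    · rintro ⟨him, hlt⟩
      have h : p.1 ∈ ⋃ n, farEventC W t hc p.2 n := by
        rw [← setOf_lt_swallowingTime_eq_iUnion_of_im_pos hc him ht]
        exact hlt
      obtain ⟨n, hn⟩ := mem_iUnion.1 h
      exact ⟨him, n, (hFiff n p).2 hn⟩
    · rintro ⟨him, n, hn⟩
      refine ⟨him, ?_⟩
      have h : p.1 ∈ ⋃ n, farEventC W t hc p.2 n := mem_iUnion.2 ⟨n, (hFiff n p).1 hn⟩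
      rw [← setOf_lt_swallowingTime_eq_iUnion_of_im_pos hc him ht] at h
      exact h
  rw [heq]
  exact (measurableSet_lt measurable_const (Complex.measurable_im.comp measurable_snd)).inter
    (MeasurableSet.iUnion hFm)

/-- **The swallowing indicator is jointly measurable**: for `t > 0` the set
`{(ω, z) | z ∈ Kₜ[W ω]}` is measurable in `Ω × ℂ`. [cite: RohdeSchramm2005, §2.1] -/
theorem measurableSet_mem_hull_prod (hc : ∀ ω, Continuous (W ω))
    (hmeas : ∀ s, s ≤ t → Measurable fun ω ↦ W ω s) (ht : 0 < t) :
    MeasurableSet {p : Ω × ℂ | p.2 ∈ hull (W p.1) t} := by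
  have h1 : MeasurableSet {p : Ω × ℂ | 0 < p.2.im} :=
    measurableSet_lt measurable_const (Complex.measurable_im.comp measurable_snd)
  have h2 := measurableSet_lt_swallowingTime_prod hc hmeas ht
  have heq : {p : Ω × ℂ | p.2 ∈ hull (W p.1) t} =
      {p : Ω × ℂ | 0 < p.2.im} \
        {p | 0 < p.2.im ∧ (t : WithTop ℝ≥0) < swallowingTime (W p.1) p.2} := by
    ext p
    constructor
    · intro hp
      have hp' : p.2 ∈ upperHalfPlaneSet ∧ swallowingTime (W p.1) p.2 ≤ t := hp
      refine ⟨hp'.1, fun h ↦ ?_⟩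
      exact (not_lt.2 hp'.2) h.2
    · rintro ⟨him, hnot⟩
      have him' : 0 < p.2.im := him
      exact ⟨him', not_lt.1 fun hlt ↦ hnot ⟨him', hlt⟩⟩
  rw [heq]
  exact h1.diff h2

end JointMeasurable

end Loewner

/-! ### The SLE instance -/

/-- **The swallowing indicator of the SLE_κ hulls is jointly measurable**: for `t > 0` the set
`{(ω, z) | z ∈ Kₜ(ω)}` is measurable in `(path space) × ℂ`, so that Tonelli applies to
`(ω, z) ↦ 1[z ∈ Kₜ(ω)]` (Rohde–Schramm (2005), proof of Lemma 7.3, p. 910: "Fubini implies …").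
[cite: RohdeSchramm2005, §2.1] -/
theorem measurableSet_mem_sleHull_prod (κ : ℝ≥0) {t : ℝ≥0} (ht : 0 < t) :
    MeasurableSet {p : (ℝ≥0 → ℝ) × ℂ | p.2 ∈ sleHull κ p.1 t} :=
  Loewner.measurableSet_mem_hull_prod (W := fun ω ↦ sleDriving κ ω) (t := t)
    (fun ω ↦ continuous_sleDriving κ ω) (fun s _ ↦ measurable_sleDriving κ s) ht

/-- **Tonelli for the swallowed region**: for `t > 0`, the expected area of `Kₜ` (within a set
`A`) is the integral over `A` of the swallowing probabilities,
`∫⁻ ω, vol(Kₜ(ω) ∩ A) dP = ∫⁻_{A} P[z ∈ Kₜ] dz` — both sides being `(P ⊗ vol){(ω, z) | z ∈ Kₜ(ω), z ∈ A}`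
(`Measure.prod_apply`, `Measure.prod_apply_symm`). [cite: RohdeSchramm2005, Lemma 7.3] -/
theorem lintegral_volume_sleHull_inter_eq (κ : ℝ≥0) {t : ℝ≥0} (ht : 0 < t) {A : Set ℂ}
    (hA : MeasurableSet A) :
    ∫⁻ ω, volume (sleHull κ ω t ∩ A) ∂Process.preWienerMeasure =
      ∫⁻ z in A, Process.preWienerMeasure {ω | z ∈ sleHull κ ω t} ∂volume := by
  haveI : IsProbabilityMeasure Process.preWienerMeasure :=
    Process.isProbabilityMeasure_preWienerMeasure
      (Process.isProjectiveLimit_preWienerMeasure_of Process.exists_isProjectiveLimit_holds)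
  set S : Set ((ℝ≥0 → ℝ) × ℂ) := {p | p.2 ∈ sleHull κ p.1 t} ∩ Prod.snd ⁻¹' A with hS
  have hSm : MeasurableSet S := (measurableSet_mem_sleHull_prod κ ht).inter (measurable_snd hA)
  have h1 : (Process.preWienerMeasure.prod volume) S =
      ∫⁻ ω, volume (sleHull κ ω t ∩ A) ∂Process.preWienerMeasure := by
    rw [Measure.prod_apply hSm]
    rfl
  have h2 : (Process.preWienerMeasure.prod volume) S =
      ∫⁻ z, Process.preWienerMeasure ((fun ω ↦ (ω, z)) ⁻¹' S) ∂volume :=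
    Measure.prod_apply_symm hSm
  rw [← h1, h2, ← lintegral_indicator hA]
  refine lintegral_congr fun z ↦ ?_
  by_cases hz : z ∈ A
  · rw [indicator_of_mem hz]
    congr 1
    ext ω
    simp [hS, hz]
  · rw [indicator_of_notMem hz]
    have : (fun ω : ℝ≥0 → ℝ ↦ (ω, z)) ⁻¹' S = ∅ := by
      ext ω
      simp [hS, hz]
    rw [this, measure_empty]

end Literature.Probability.RandomPlanarGeometry
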